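import Literature.AlgebraicGeometry.HodgeTheory.RibetTypeOnePowersHodgeClasses
import Literature.AlgebraicGeometry.HodgeTheory.RibetTypeTwoOddPowersHodgeClasses
import Literature.AlgebraicGeometry.HodgeTheory.RibetTypeThreeCoprimePowersHodgeClasses
import Literature.AlgebraicGeometry.HodgeTheory.RibetTypeFivePowersHodgeClasses
import HarnessLib

/-!
# Ribet's theorem (1983, Thm. 3) for coprime multiplicities `(n′, n″)` with `min(n′, n″) ≤ 4`: Hodge classes on all
# powers are generated by divisor classes — UNCONDITIONAL, classification-free (one packaged statement)

Family `hodge`, layer `Literature/AlgebraicGeometry/HodgeTheory`. Research context: cell `pub-hodge-ring2` (HONEST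
FRAMING: research route conditional on HC_CM; not a corollary; Q11.4-sentence-2 already refuted in dim ≥ 3),
Literature lane gen 83, programme R65 (packaging). UNCONDITIONAL; theorems only, no definition, no named fact (D-0026),
no `sorry`. Ribet's Theorem 3 [Amer. J. Math. 105 (1983) = Gordon's survey Thm. 6.3 (3), held `paper:arxiv-alg-geom_9709030`
p. 18]: a complex abelian variety `A` with `End⁰(A) = k` imaginary quadratic acting with COPRIME multiplicities `(n′, n″)`
has `Hg(A) = U(V, φ)` and `B•(Aⁿ) = D•(Aⁿ)` for all `n`. The tree proves it without the classification of Hermitian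
symmetric Lie algebras whenever `min(n′, n″) ≤ 4` — the cells `RibetTypeOne…` (`n′ = 1`), `RibetTypeTwoOdd…` (`n′ = 2`,
coprime ⟺ `n″` odd), `RibetTypeThreeCoprime…` (`n′ = 3`, coprime ⟺ `3 ∤ n″`), `RibetTypeFourOdd…` (`n′ = 4`, coprime ⟺ `n″`
odd) — and this file packages them into ONE statement with Ribet's own hypothesis `Nat.Coprime n′ n″`; for `min = 5` the
tree has the half `n″ ≡ ±2 (mod 5)` (`RibetTypeFive…`), recorded as a second statement.

## References
* [Ribet1983] K. A. Ribet, *Hodge classes on certain types of abelian varieties*, Amer. J. Math. 105 (1983), Thm. 0, Thm. 3.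
* [Gordon1997] B. B. Gordon, *A survey of the Hodge conjecture for abelian varieties*, Thm. 6.3 (3) and Corollary.
* [Deligne2000] P. Deligne, *The Hodge conjecture* (Clay, 2000), §1.
-/

noncomputable section

open CategoryTheory Module

namespace Literature.AlgebraicGeometry.HodgeTheory

open Literature.AlgebraicGeometry.Motives

section Main

/-- **Ribet 1983, Thm. 3, for coprime multiplicities with `min(n′, n″) ≤ 4` — UNCONDITIONAL and classification-free:**
a complex abelian variety `A` of dimension `≥ 3` with `φ ≫ φ = -d` (`d > 0`), `finrank_ℚ End⁰(A) = 2`, and multiplicities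
`n′ = n_{i√d}(φ)`, `n″ = n_{−i√d}(φ)` with `gcd(n′, n″) = 1` and `min(n′, n″) ≤ 4` has `B•(A^{N+1}) = D•(A^{N+1}) ⊗ ℂ` for
every `N`. [cite: Ribet1983, Thm. 0 and Thm. 3] [cite: Gordon1997, Thm. 6.3 (3) and Corollary] -/
theorem AbelianVariety.isDivisorGenerated_powSucc_of_ribetType_coprime_min_le_four (A : AbelianVariety ℂ) (φ : A ⟶ A)
    {d : ℕ} (hd : 0 < d) (hφ : φ ≫ φ = -(d • 𝟙 A)) (hE2 : Module.finrank ℚ A.endAlgebra = 2) (hdim : 3 ≤ A.dim)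
    (hcop : Nat.Coprime (eigenMultiplicity A φ (Complex.I * (Real.sqrt d : ℂ)))
      (eigenMultiplicity A φ (-(Complex.I * (Real.sqrt d : ℂ)))))
    (hmin : eigenMultiplicity A φ (Complex.I * (Real.sqrt d : ℂ)) ≤ 4 ∨
      eigenMultiplicity A φ (-(Complex.I * (Real.sqrt d : ℂ))) ≤ 4) (N : ℕ) :
    IsDivisorGenerated (A.powSucc N) := by
  have hsum := eigenMultiplicity_add_eigenMultiplicity_neg_eq_dim A φ hd hφ
  -- the four shapes, for a multiplicity `m ∈ {n′, n″}` coprime to the other one `m'` (`m + m' = dim A`)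
  have key : ∀ m m' : ℕ, m + m' = A.dim → Nat.Coprime m m' → m ≤ 4 →
      (eigenMultiplicity A φ (Complex.I * (Real.sqrt d : ℂ)) = m ∨
        eigenMultiplicity A φ (-(Complex.I * (Real.sqrt d : ℂ))) = m) → IsDivisorGenerated (A.powSucc N) := by
    intro m m' hmm' hc hm4 hwhich
    have hm0 : m ≠ 0 := by
      rintro rfl
      rw [Nat.coprime_zero_left] at hc
      omega
    by_cases hm1 : m = 1
    · subst hm1
      exact AbelianVariety.isDivisorGenerated_powSucc_of_ribetTypeOne A φ hd hφ hE2 hwhich hdim N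
    by_cases hm2 : m = 2
    · subst hm2
      have hodd : Odd m' := Nat.coprime_two_left.1 hc
      obtain ⟨k, hk⟩ := hodd
      exact AbelianVariety.isDivisorGenerated_powSucc_of_ribetTypeTwoOdd A φ hd hφ hE2 ⟨k + 1, by omega⟩ hwhich N
    by_cases hm3 : m = 3
    · subst hm3
      have h3 : ¬ 3 ∣ m' := (Nat.Prime.coprime_iff_not_dvd Nat.prime_three).1 hc
      have h3dim : ¬ 3 ∣ A.dim := by omega
      exact AbelianVariety.isDivisorGenerated_powSucc_of_ribetTypeThreeCoprime A φ hd hφ hE2 h3dim hwhich N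
    have hm4' : m = 4 := by omega
    subst hm4'
    have h2 : Nat.Coprime 2 m' := Nat.Coprime.coprime_dvd_left (by norm_num) hc
    obtain ⟨k, hk⟩ := Nat.coprime_two_left.1 h2
    exact AbelianVariety.isDivisorGenerated_powSucc_of_ribetTypeFourOdd A φ hd hφ hE2 ⟨k + 2, by omega⟩ hwhich N
  rcases hmin with h | h
  · exact key _ _ hsum hcop h (Or.inl rfl)
  · exact key _ _ (by rw [← hsum, add_comm]) hcop.symm h (Or.inr rfl)

/-- **The Hodge conjecture for all powers of an abelian variety of Ribet type with coprime multiplicities,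
`min(n′, n″) ≤ 4` — UNCONDITIONAL.** [cite: Ribet1983, Thm. 3] [cite: Deligne2000, §1] -/
theorem hodgeConjectureFor_powSucc_of_ribetType_coprime_min_le_four (A : AbelianVariety ℂ) (φ : A ⟶ A)
    {d : ℕ} (hd : 0 < d) (hφ : φ ≫ φ = -(d • 𝟙 A)) (hE2 : Module.finrank ℚ A.endAlgebra = 2) (hdim : 3 ≤ A.dim)
    (hcop : Nat.Coprime (eigenMultiplicity A φ (Complex.I * (Real.sqrt d : ℂ)))
      (eigenMultiplicity A φ (-(Complex.I * (Real.sqrt d : ℂ)))))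
    (hmin : eigenMultiplicity A φ (Complex.I * (Real.sqrt d : ℂ)) ≤ 4 ∨
      eigenMultiplicity A φ (-(Complex.I * (Real.sqrt d : ℂ))) ≤ 4) (N : ℕ) :
    HodgeConjectureFor (A.powSucc N).dim (A.powSucc N).X :=
  hodgeConjectureFor_of_isDivisorGenerated _
    (AbelianVariety.isDivisorGenerated_powSucc_of_ribetType_coprime_min_le_four A φ hd hφ hE2 hdim hcop hmin N)

/-- **Ribet 1983, Thm. 3, for `min(n′, n″) = 5` and `max(n′, n″) ≡ ±2 (mod 5)` — UNCONDITIONAL** (the half of the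
coprime pairs with `min = 5` reached by the tree's raising-rank lemmas; `max ≡ ±1 (mod 5)` is not covered).
[cite: Ribet1983, Thm. 0 and Thm. 3] [cite: Gordon1997, Thm. 6.3 (3) and Corollary] -/
theorem AbelianVariety.isDivisorGenerated_powSucc_of_ribetType_five_pmTwo (A : AbelianVariety ℂ) (φ : A ⟶ A)
    {d : ℕ} (hd : 0 < d) (hφ : φ ≫ φ = -(d • 𝟙 A)) (hE2 : Module.finrank ℚ A.endAlgebra = 2)
    (h5 : eigenMultiplicity A φ (Complex.I * (Real.sqrt d : ℂ)) = 5 ∨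
      eigenMultiplicity A φ (-(Complex.I * (Real.sqrt d : ℂ))) = 5)
    (hmod : (A.dim - 5) % 5 = 2 ∨ (A.dim - 5) % 5 = 4) (N : ℕ) : IsDivisorGenerated (A.powSucc N) := by
  have hsum := eigenMultiplicity_add_eigenMultiplicity_neg_eq_dim A φ hd hφ
  rcases h5 with h | h
  · have hm : eigenMultiplicity A φ (-(Complex.I * (Real.sqrt d : ℂ))) = A.dim - 5 := by omega
    exact AbelianVariety.isDivisorGenerated_powSucc_of_ribetTypeFive A φ hd hφ hE2 h (by rw [hm]; exact hmod) N
  · have hm : eigenMultiplicity A φ (Complex.I * (Real.sqrt d : ℂ)) = A.dim - 5 := by omega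
    exact AbelianVariety.isDivisorGenerated_powSucc_of_ribetTypeFive' A φ hd hφ hE2 (by rw [hm]; exact hmod) h N

end Main

end Literature.AlgebraicGeometry.HodgeTheory

end
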